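import Summits.ABC.ABC.Theses.CongruentialReceptacle

/-!
# Crux `CongruentialReceptacle.TameLocalReceptacle` (stmt-ABC-14354): objects of the line
`SketchIdeator1` (idea `ternary-smooth-pinning`)

Definitions used by the files of this crux's checked skeleton
`Cruxes/TameLocalReceptacle/Lines/SketchIdeator1.lean` (lead `prover-line-stmt-ABC-14354-0`,
registered with `ledger skeleton check`, 2026-08-16) and by its composition theorem:

* `Table`, `RTable` — integer tables `t(p; i,j,k; r,s,z)` on tame data and real test weights;
* `InWindow ε c₁ c₁' t` — the crux's two windows, verbatim;
* `datum a b c p` — the tame datum `D_p = (v_p a, v_p b, v_p c; a′ mod p, b′ mod p, c′ mod p)`,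
  `evalAt` — evaluation of a curried table at a datum;
* `recSum t a b c` — the receptacle sum `Σ_{p ∣ abc} t(p; D_p)`, literally the sum in the crux;
  `recSumAway w p a b c` — the same for a real weight, omitting one prime;
* `IsBalanced κ a b c` — the `κ`-balanced cell of the crux;
* `IntegerTameReceptacle` — the TRANSFER C⁺ of the idea card: ONE table, exact bounded sum, no modulus;
  it is EQUIVALENT to the crux, and the equivalence is proved here: `itr_of_tlr` (compactness of the
  product of the finite windows, `isCompact_univ_pi` + `IsCompact.tendsto_subseq`; for a fixed triple
  the congruence at a prime modulus above `|Φ| + c₃` is an equality) and the registered stub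
  `stub_tlr_iff_itr : TameLocalReceptacle ↔ IntegerTameReceptacle`;
* `WindowBounded`, `Occurs`, `mean`, `PinningFamilies κ A` — the ternary-smooth residue-pinning
  hypothesis EH in exactly the form the line consumes it (the `--negative-modulo` hypothesis of the
  line's composition), and `NearResidueFree κ K t` — residue-freeness up to `K` on occurring data.

Statements are verbatim those of the planner's checked sketch (planner-cruxidea-stmt-ABC-14354-1-0,
`Cruxes/TameLocalReceptacle/SketchIdeator1.lean`), moved here per CONVENTIONS §6 (route-posited objects
live in `<Route><Crux>Defs.lean`, never in a proof file).
-/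

-- `Summit.<Summit>.<Problem>` is the mandated summit-side namespace (CONVENTIONS §2); for the
-- single-conjunct summit `ABC` the two coincide, so the duplicate `ABC.ABC` is deliberate.
set_option linter.dupNamespace false

namespace Summit.ABC.ABC.Theorems.TameLocalReceptacle

open Finset Filter Topology Literature.NumberTheory.DiophantineGeometry
open Summit.ABC.ABC.Theses.CongruentialReceptacle

/-- A tame-local integer table `t(p; i,j,k; r,s,z)`. -/
abbrev Table : Type := ℕ → ℕ → ℕ → ℕ → ℕ → ℕ → ℕ → ℤ

/-- A real-valued weight on tame data (test functions for intensity comparison). -/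
abbrev RTable : Type := ℕ → ℕ → ℕ → ℕ → ℕ → ℕ → ℕ → ℝ

/-- The crux's window for constants `(ε, c₁, c₁')`. -/
def InWindow (ε c₁ c₁' : ℝ) (t : Table) : Prop :=
  ∀ p i j k r s z : ℕ, p.Prime →
    c₁ * (2 * ((i + j + k : ℕ) : ℝ) - 6 - ε) * Real.log p ≤ (t p i j k r s z : ℝ) ∧
      |(t p i j k r s z : ℝ)| ≤ c₁' * (((i + j + k : ℕ) : ℝ) + 1) * Real.log p

/-- The tame datum `D_p(a,b,c) = (v_p a, v_p b, v_p c; a' mod p, b' mod p, c' mod p)`. -/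
def datum (a b c p : ℕ) : ℕ × ℕ × ℕ × ℕ × ℕ × ℕ :=
  (a.factorization p, b.factorization p, c.factorization p,
    a / p ^ a.factorization p % p, b / p ^ b.factorization p % p, c / p ^ c.factorization p % p)

/-- Evaluate a (curried) table at a datum. -/
def evalAt {β : Type} (t : ℕ → ℕ → ℕ → ℕ → ℕ → ℕ → ℕ → β) (p : ℕ) (D : ℕ × ℕ × ℕ × ℕ × ℕ × ℕ) : β :=
  t p D.1 D.2.1 D.2.2.1 D.2.2.2.1 D.2.2.2.2.1 D.2.2.2.2.2

/-- The receptacle sum `Φ_t(a,b,c) = Σ_{p ∣ abc} t(p; D_p)` — literally the sum in the crux. -/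
def recSum (t : Table) (a b c : ℕ) : ℤ :=
  ∑ p ∈ (a * b * c).primeFactors, t p (a.factorization p) (b.factorization p) (c.factorization p)
    (a / p ^ a.factorization p % p) (b / p ^ b.factorization p % p) (c / p ^ c.factorization p % p)

/-- The same sum for a real weight, omitting one prime `p` (the "other data" of a triple). -/
noncomputable def recSumAway (w : RTable) (p a b c : ℕ) : ℝ :=
  ∑ q ∈ ((a * b * c).primeFactors).erase p, evalAt w q (datum a b c q)

/-- `κ`-balanced abc triple (the cell of the crux). -/
def IsBalanced (κ : ℝ) (a b c : ℕ) : Prop :=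
  IsABCTriple a b c ∧ κ * (c : ℝ) ≤ (a : ℝ) ∧ κ * (c : ℝ) ≤ (b : ℝ)

/-- TRANSFER C⁺ — the single-table (modulus-free) tame receptacle: ONE integer table in the crux's
windows whose sum over the primes of every `κ`-balanced triple is bounded by `c₃` in absolute value. -/
def IntegerTameReceptacle : Prop :=
  ∀ κ : ℝ, 0 < κ → ∀ ε : ℝ, 0 < ε → ∃ c₁ c₁' c₃ : ℝ, 0 < c₁ ∧ ∃ t : Table, InWindow ε c₁ c₁' t ∧
    ∀ a b c : ℕ, IsBalanced κ a b c → |(recSum t a b c : ℝ)| ≤ c₃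

/-- A real weight bounded by the (c₁' = 1) upper window. -/
def WindowBounded (w : RTable) : Prop :=
  ∀ q i j k r s z : ℕ, q.Prime → |w q i j k r s z| ≤ (((i + j + k : ℕ) : ℝ) + 1) * Real.log q

/-- A datum `D` OCCURS at `p` on the `κ`-balanced cell. -/
def Occurs (κ : ℝ) (p : ℕ) (D : ℕ × ℕ × ℕ × ℕ × ℕ × ℕ) : Prop :=
  ∃ a b c : ℕ, IsBalanced κ a b c ∧ p ∈ (a * b * c).primeFactors ∧ datum a b c p = D

/-- The mean of `f` over a finite family of triples. -/
noncomputable def mean (F : Finset (ℕ × ℕ × ℕ)) (f : ℕ × ℕ × ℕ → ℝ) : ℝ :=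
  (∑ T ∈ F, f T) / F.card

/-- EH — TERNARY-SMOOTH RESIDUE-PINNING HYPOTHESIS with absolute discrepancy `A` (the analytic input,
stated in exactly the form used).  For any prime `p` and two data at `p` with the same exponents
`(i,j,k)` that both occur on the `κ`-balanced cell, there are finite nonempty families `F, F'` of
`κ`-balanced triples carrying these data at `p` whose OTHER data have window-weighted intensity
measures within `A`: every window-bounded weight has family means (away from `p`) within `A`.
Intended witnesses: `X^{1/3}`-smooth balanced triples `≤ X` conditioned at `p` (no informed prime),
counted by the circle method for friable `a + b = c` with two-prime congruence conditions
[Harper2016 Cor. 1 = `Literature.NumberTheory.DiophantineGeometry.XYZUpperHalf` doc; LagariasSoundararajan2011;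
de la Bretèche 1999] at Bombieri–Vinogradov-level uniformity in the data prime `q ≤ X^{1/3}`. -/
def PinningFamilies (κ A : ℝ) : Prop :=
  ∀ (p i j k r s z r' s' z' : ℕ), p.Prime →
    Occurs κ p (i, j, k, r, s, z) → Occurs κ p (i, j, k, r', s', z') →
    ∃ F F' : Finset (ℕ × ℕ × ℕ), F.Nonempty ∧ F'.Nonempty ∧
      (∀ T ∈ F, IsBalanced κ T.1 T.2.1 T.2.2 ∧ p ∈ (T.1 * T.2.1 * T.2.2).primeFactors ∧
        datum T.1 T.2.1 T.2.2 p = (i, j, k, r, s, z)) ∧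
      (∀ T ∈ F', IsBalanced κ T.1 T.2.1 T.2.2 ∧ p ∈ (T.1 * T.2.1 * T.2.2).primeFactors ∧
        datum T.1 T.2.1 T.2.2 p = (i, j, k, r', s', z')) ∧
      ∀ w : RTable, WindowBounded w →
        |mean F (fun T => recSumAway w p T.1 T.2.1 T.2.2) -
          mean F' (fun T => recSumAway w p T.1 T.2.1 T.2.2)| ≤ A

/-- Near-residue-freeness with slack `K`: two OCCURRING data at the same `(p; i,j,k)` get table
values within `K` of each other. -/
def NearResidueFree (κ K : ℝ) (t : Table) : Prop :=
  ∀ (p i j k r s z r' s' z' : ℕ), p.Prime →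
    Occurs κ p (i, j, k, r, s, z) → Occurs κ p (i, j, k, r', s', z') →
    |(t p i j k r s z : ℝ) - (t p i j k r' s' z' : ℝ)| ≤ K

/-! ## The transfer: crux ⇔ single-table receptacle (proved) -/

/-- Hard half of the transfer (PROVED): compactness of the product of the finite windows
(`isCompact_univ_pi` + `IsCompact.tendsto_subseq`): from tables `t_ℓ` (ℓ prime → ∞, n = 1)
extract a pointwise limit; for a fixed triple all its data are eventually stable, `ℓ ∤ abc`, and the
congruence at a modulus `ℓ > |Φ| + c₃` is an equality (`Int.eq_zero_of_abs_lt_dvd`). -/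
theorem itr_of_tlr (h : TameLocalReceptacle) : IntegerTameReceptacle := by
  intro κ hκ ε hε
  obtain ⟨c₁, c₁', c₃, hc₁, m₀, H⟩ := h κ hκ ε hε
  -- a sequence of primes ℓ N ≥ max m₀ (max 5 N)
  choose ℓ hℓ using fun N : ℕ => Nat.exists_infinite_primes (max m₀ (max 5 N))
  have hℓN : ∀ N, N ≤ ℓ N := fun N => le_trans (le_max_right _ _ |>.trans (le_max_right _ _)) (hℓ N).1
  -- tables for the moduli ℓ N (exponent 1)
  have hT : ∀ N : ℕ, ∃ t : Table, InWindow ε c₁ c₁' t ∧ ∀ a b c : ℕ, IsABCTriple a b c →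
      κ * (c : ℝ) ≤ (a : ℝ) → κ * (c : ℝ) ≤ (b : ℝ) → ¬ ℓ N ∣ a * b * c →
      ∃ B : ℤ, |(B : ℝ)| ≤ c₃ ∧ recSum t a b c ≡ B [ZMOD ((ℓ N ^ 1 : ℕ) : ℤ)] := by
    intro N
    have h5 : 5 ≤ ℓ N := le_trans (le_max_left _ _ |>.trans (le_max_right _ _)) (hℓ N).1
    have hm : m₀ ≤ ℓ N ^ 1 := by rw [pow_one]; exact le_trans (le_max_left _ _) (hℓ N).1
    obtain ⟨t, ht, hB⟩ := H (ℓ N) 1 (hℓ N).2 h5 hm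
    exact ⟨t, ht, hB⟩
  choose t ht hB using hT
  -- uncurried, prime-truncated tables living in a compact box
  let T : ℕ → (ℕ × ℕ × ℕ × ℕ × ℕ × ℕ × ℕ) → ℤ := fun N x =>
    if x.1.Prime then t N x.1 x.2.1 x.2.2.1 x.2.2.2.1 x.2.2.2.2.1 x.2.2.2.2.2.1 x.2.2.2.2.2.2 else 0
  let R : (ℕ × ℕ × ℕ × ℕ × ℕ × ℕ × ℕ) → ℝ := fun x => c₁' * (((x.2.1 + x.2.2.1 + x.2.2.2.1 : ℕ) : ℝ) + 1) * Real.log x.1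
  let K : (ℕ × ℕ × ℕ × ℕ × ℕ × ℕ × ℕ) → Set ℤ := fun x => {m : ℤ | |(m : ℝ)| ≤ R x} ∪ {0}
  have hKfin : ∀ x, (K x).Finite := by
    intro x
    refine Set.Finite.union ?_ (Set.finite_singleton 0)
    refine (Set.finite_Icc ⌊-R x⌋ ⌈R x⌉).subset ?_
    intro m hm
    simp only [Set.mem_setOf_eq] at hm
    obtain ⟨h1, h2⟩ := abs_le.mp hm
    refine ⟨?_, ?_⟩
    · have : ((⌊-R x⌋ : ℤ) : ℝ) ≤ (m : ℝ) := (Int.floor_le _).trans h1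
      exact_mod_cast this
    · have : (m : ℝ) ≤ ((⌈R x⌉ : ℤ) : ℝ) := h2.trans (Int.le_ceil _)
      exact_mod_cast this
  have hs : IsCompact (Set.pi Set.univ K) := isCompact_univ_pi fun x => (hKfin x).isCompact
  have hmem : ∀ N, T N ∈ Set.pi Set.univ K := by
    intro N
    refine Set.mem_univ_pi.2 fun x => ?_
    by_cases hp : x.1.Prime
    · left
      simp only [Set.mem_setOf_eq, T, if_pos hp]
      exact (ht N x.1 x.2.1 x.2.2.1 x.2.2.2.1 x.2.2.2.2.1 x.2.2.2.2.2.1 x.2.2.2.2.2.2 hp).2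
    · right
      simp [T, if_neg hp]
  obtain ⟨g, -, φ, hφ, hlim⟩ := hs.tendsto_subseq hmem
  have hev : ∀ x : ℕ × ℕ × ℕ × ℕ × ℕ × ℕ × ℕ, ∀ᶠ N in atTop, T (φ N) x = g x := by
    intro x
    have hx := tendsto_pi_nhds.1 hlim x
    simp only [nhds_discrete, tendsto_pure] at hx
    exact hx
  -- the limit table
  let tinf : Table := fun p i j k r s z => g (p, i, j, k, r, s, z)
  refine ⟨c₁, c₁', c₃, hc₁, tinf, ?_, ?_⟩
  · -- windows pass to the limit
    intro p i j k r s z hp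
    obtain ⟨N, hN⟩ := (hev (p, i, j, k, r, s, z)).exists
    have hTN : T (φ N) (p, i, j, k, r, s, z) = t (φ N) p i j k r s z := by
      simp only [T]
      rw [if_pos hp]
    have hg : tinf p i j k r s z = t (φ N) p i j k r s z := by
      show g (p, i, j, k, r, s, z) = _
      rw [← hN, hTN]
    rw [hg]
    exact ht (φ N) p i j k r s z hp
  · -- exact boundedness on the balanced cell
    rintro a b c ⟨habc, ha, hb⟩
    set pf := (a * b * c).primeFactors with hpf
    let xi : ℕ → ℕ × ℕ × ℕ × ℕ × ℕ × ℕ × ℕ := fun p => (p, a.factorization p, b.factorization p, c.factorization p,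
      a / p ^ a.factorization p % p, b / p ^ b.factorization p % p, c / p ^ c.factorization p % p)
    let Z : ℝ := ∑ p ∈ pf, c₁' * (((a.factorization p + b.factorization p + c.factorization p : ℕ)
      : ℝ) + 1) * Real.log p
    have h1 : ∀ᶠ N in atTop, ∀ p ∈ pf, T (φ N) (xi p) = g (xi p) :=
      (eventually_all_finset pf).2 fun p _ => hev (xi p)
    have h2 : ∀ᶠ N in atTop, a * b * c < N := eventually_gt_atTop _
    have h3 : ∀ᶠ N : ℕ in atTop, c₃ + Z < (N : ℝ) :=
      tendsto_natCast_atTop_atTop.eventually_gt_atTop _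
    obtain ⟨N, hN1, hN2, hN3⟩ := (h1.and (h2.and h3)).exists
    have hφN : N ≤ φ N := hφ.id_le N
    have hLgt : a * b * c < ℓ (φ N) := lt_of_lt_of_le hN2 (hφN.trans (hℓN _))
    have hLgtR : c₃ + Z < (ℓ (φ N) : ℝ) := by
      refine lt_of_lt_of_le hN3 ?_
      exact_mod_cast hφN.trans (hℓN _)
    obtain ⟨ha0, hb0, hsum, hcop⟩ := habc
    have habc0 : 0 < a * b * c := by
      have : 0 < c := by omega
      positivity
    have hndvd : ¬ ℓ (φ N) ∣ a * b * c := Nat.not_dvd_of_pos_of_lt habc0 hLgt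
    obtain ⟨B, hBle, hmod⟩ := hB (φ N) a b c ⟨ha0, hb0, hsum, hcop⟩ ha hb hndvd
    -- the limit table agrees with t (φ N) on the data of this triple
    have hagree : recSum tinf a b c = recSum (t (φ N)) a b c := by
      refine Finset.sum_congr rfl fun p hp => ?_
      have hpp : p.Prime := Nat.prime_of_mem_primeFactors hp
      have hTx : T (φ N) (xi p) = t (φ N) p (a.factorization p) (b.factorization p)
          (c.factorization p) (a / p ^ a.factorization p % p) (b / p ^ b.factorization p % p)
          (c / p ^ c.factorization p % p) := by
        simp only [T, xi]
        rw [if_pos hpp]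
      show g (xi p) = _
      rw [← hN1 p hp, hTx]
    -- a priori bound |recSum (t (φ N))| ≤ Z
    have hZ : |(recSum (t (φ N)) a b c : ℝ)| ≤ Z := by
      simp only [recSum, Int.cast_sum]
      refine (abs_sum_le_sum_abs _ _).trans (Finset.sum_le_sum fun p hp => ?_)
      exact (ht (φ N) p _ _ _ _ _ _ (Nat.prime_of_mem_primeFactors hp)).2
    -- congruence to equality
    have hdvd : ((ℓ (φ N) : ℕ) : ℤ) ∣ B - recSum (t (φ N)) a b c := by
      have := hmod.dvd
      simpa [pow_one] using this
    have hlt : |B - recSum (t (φ N)) a b c| < ((ℓ (φ N) : ℕ) : ℤ) := by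
      have hR : |((B - recSum (t (φ N)) a b c : ℤ) : ℝ)| < (ℓ (φ N) : ℝ) := by
        push_cast
        calc |(B : ℝ) - (recSum (t (φ N)) a b c : ℝ)|
            ≤ |(B : ℝ)| + |(recSum (t (φ N)) a b c : ℝ)| := abs_sub _ _
          _ ≤ c₃ + Z := add_le_add hBle hZ
          _ < ℓ (φ N) := hLgtR
      exact_mod_cast hR
    have hzero : B - recSum (t (φ N)) a b c = 0 := Int.eq_zero_of_abs_lt_dvd hdvd hlt
    have hEq : recSum tinf a b c = B := by rw [hagree]; omega
    rw [hEq]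
    exact hBle

/-- **TRANSFER** (registered stub `stub_tlr_iff_itr` of the checked skeleton of stmt-ABC-14354, line
`SketchIdeator1`): the crux is equivalent to the single-table receptacle — `→` is `itr_of_tlr`
(compactness); `←`: a single exact table serves every modulus (`m₀ := 0`, `B := Φ_t`). [folklore] -/
theorem stub_tlr_iff_itr : TameLocalReceptacle ↔ IntegerTameReceptacle := by
  refine ⟨itr_of_tlr, fun h => ?_⟩
  intro κ hκ ε hε
  obtain ⟨c₁, c₁', c₃, hc₁, t, hw, hB⟩ := h κ hκ ε hε
  refine ⟨c₁, c₁', c₃, hc₁, 0, fun ℓ n _ _ _ => ⟨t, hw, fun a b c habc ha hb _ => ?_⟩⟩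
  exact ⟨recSum t a b c, hB a b c ⟨habc, ha, hb⟩, Int.ModEq.refl _⟩


/-! ## Objects of the reshaped analytic stub (lead prover-line-stmt-ABC-14354-c1-0, cycle 2)

The first-moment five-family argument needs, instead of entry-wise pinning to `O(1)` (`PinningFamilies`,
a log-saving), only that position-wise ODD-prime data means of three special families (one member
`2^N · m`, `m` odd generic) match those of two generic families to RELATIVE precision `o(1)` — slack
`δ·N` for every `δ > 0`.  The objects: the three position parts of a weighted sum away from the prime `2`,
and the hypothesis `MatchingFamilies κ`. -/

/-- A-position part of the weighted tame sum away from `2`: `Σ_{q ∣ a, q ≠ 2} w(q; D_q(a,b,c))`. -/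
noncomputable def oddPartA (w : RTable) (a b c : ℕ) : ℝ :=
  ∑ q ∈ a.primeFactors.erase 2, evalAt w q (datum a b c q)

/-- B-position part of the weighted tame sum away from `2`: `Σ_{q ∣ b, q ≠ 2} w(q; D_q(a,b,c))`. -/
noncomputable def oddPartB (w : RTable) (a b c : ℕ) : ℝ :=
  ∑ q ∈ b.primeFactors.erase 2, evalAt w q (datum a b c q)

/-- C-position part of the weighted tame sum away from `2`: `Σ_{q ∣ c, q ≠ 2} w(q; D_q(a,b,c))`. -/
noncomputable def oddPartC (w : RTable) (a b c : ℕ) : ℝ :=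
  ∑ q ∈ c.primeFactors.erase 2, evalAt w q (datum a b c q)

/-- MF — FIRST-MOMENT MATCHING HYPOTHESIS at balance `κ` (the qualitative analytic input of the reshaped
line `SketchIdeator1`; a HYPOTHESIS, consumed as the `--negative-modulo` premise of the composition).
For some bound `V₀` on the `2`-part of the generic families, every `δ > 0` and arbitrarily large `N`
there are five finite nonempty families of `κ`-balanced abc-triples — `F_A, F_B, F_C` whose `a`-, `b`-,
resp. `c`-member is EXACTLY divisible by `2^N` (so its datum at `2` is `(N,0,0;1,1,1)` etc.), and `G, G'`
with `v₂(abc) ≤ V₀` — such that for every window-bounded real weight `w` the family means of the three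
odd-prime position parts match within `δ·N`: the special member's own part against `G'` (the smaller
scale `X/2^N`), the two other parts against `G` (the scale `X`).  Intended witnesses (NOT constructed
here): `y`-smooth box families, `y = X^η`, `η < (1 − θ)/2`, `N log 2 = θ log X`, special member
`2^N·m` with `m` odd `y`-smooth of size `X/2^N` — no prime is informed (NegativeNotes-ideator1 §2), partner
and cofactor residues are uniform on units, and the cell laws of tame data among `y`-smooth solutions of
`a + b = c` with congruence conditions to moduli `q^{v+1} ≤ y^{O(1)}` agree to relative precision `o(1)`
(ternary friable equidistribution: de la Bretèche 1999, Drappeau 2015, Harper 2016; friable numbers in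
progressions to `y^{4√e−δ}`: Soundararajan 2008 / Harper 2012).  Compared with `PinningFamilies` (absolute
slack `A`, i.e. relative precision `O(1/log X)`) this asks only relative precision `o(1)`; neither implies
the other formally.  Consumed by `stub_false_of_matching : MatchingFamilies κ → 0 < κ → ¬ IntegerTameReceptacle`. -/
def MatchingFamilies (κ : ℝ) : Prop :=
  ∃ V₀ : ℕ, ∀ δ : ℝ, 0 < δ → ∀ N₁ : ℕ, ∃ N : ℕ, N₁ ≤ N ∧
    ∃ FA FB FC G G' : Finset (ℕ × ℕ × ℕ),
      FA.Nonempty ∧ FB.Nonempty ∧ FC.Nonempty ∧ G.Nonempty ∧ G'.Nonempty ∧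
      (∀ T ∈ FA, IsBalanced κ T.1 T.2.1 T.2.2 ∧ T.1.factorization 2 = N) ∧
      (∀ T ∈ FB, IsBalanced κ T.1 T.2.1 T.2.2 ∧ T.2.1.factorization 2 = N) ∧
      (∀ T ∈ FC, IsBalanced κ T.1 T.2.1 T.2.2 ∧ T.2.2.factorization 2 = N) ∧
      (∀ T ∈ G, IsBalanced κ T.1 T.2.1 T.2.2 ∧ (T.1 * T.2.1 * T.2.2).factorization 2 ≤ V₀) ∧
      (∀ T ∈ G', IsBalanced κ T.1 T.2.1 T.2.2 ∧ (T.1 * T.2.1 * T.2.2).factorization 2 ≤ V₀) ∧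
      ∀ w : RTable, WindowBounded w →
        |mean FA (fun T => oddPartA w T.1 T.2.1 T.2.2) - mean G' (fun T => oddPartA w T.1 T.2.1 T.2.2)|
            ≤ δ * N ∧
        |mean FA (fun T => oddPartB w T.1 T.2.1 T.2.2) - mean G (fun T => oddPartB w T.1 T.2.1 T.2.2)|
            ≤ δ * N ∧
        |mean FA (fun T => oddPartC w T.1 T.2.1 T.2.2) - mean G (fun T => oddPartC w T.1 T.2.1 T.2.2)|
            ≤ δ * N ∧
        |mean FB (fun T => oddPartA w T.1 T.2.1 T.2.2) - mean G (fun T => oddPartA w T.1 T.2.1 T.2.2)|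
            ≤ δ * N ∧
        |mean FB (fun T => oddPartB w T.1 T.2.1 T.2.2) - mean G' (fun T => oddPartB w T.1 T.2.1 T.2.2)|
            ≤ δ * N ∧
        |mean FB (fun T => oddPartC w T.1 T.2.1 T.2.2) - mean G (fun T => oddPartC w T.1 T.2.1 T.2.2)|
            ≤ δ * N ∧
        |mean FC (fun T => oddPartA w T.1 T.2.1 T.2.2) - mean G (fun T => oddPartA w T.1 T.2.1 T.2.2)|
            ≤ δ * N ∧
        |mean FC (fun T => oddPartB w T.1 T.2.1 T.2.2) - mean G (fun T => oddPartB w T.1 T.2.1 T.2.2)|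
            ≤ δ * N ∧
        |mean FC (fun T => oddPartC w T.1 T.2.1 T.2.2) - mean G' (fun T => oddPartC w T.1 T.2.1 T.2.2)|
            ≤ δ * N

end Summit.ABC.ABC.Theorems.TameLocalReceptacle
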